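import Summits.CriticalPhenomena.SAWScalingLimit.Theorems.SAWTotalPositivityCriticalBubbleBoundDockingUnflip
import Summits.CriticalPhenomena.SAWScalingLimit.Theorems.SAWTotalPositivityCriticalBubbleBoundDockingReduction

/-!
# Docking entropy with exponent `0` (line `docking-census-joining`, stub `dockingEntropy_zero`)

Crux `stmt-CriticalPhenomena-7117`
(`Summit.CriticalPhenomena.SAWScalingLimit.Theses.SAWTotalPositivity.CriticalBubbleBound`), line
`docking-census-joining`, registered stub `dockingEntropy_zero : DockingEntropy 0` — the provable
floor `κ = 0` of the line's open constructive conjecture `DockingEntropy (5/8)`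
(`…Theorems.SAWTotalPositivityCriticalBubbleBoundDockingReduction`; objects `term`, `block`,
`blockMass`, `verts`, `pedges`, `rootEdge`, `shift`, `dockings`, `dockMass` of
`…Theorems.SAWTotalPositivityCriticalBubbleBoundDockingDefs`).

**Statement.** `DockingEntropy 0` with `c = 1/2`, `i₀ = 1`: `(1/2) 2^{-i} R_i² ≤ dockMass i` for
`i ≥ 1`, `R_i = Σ_{n ∈ B_i} c_n(0,e₀) x_c^n`. **Proof (extremal-row dockings).**
* Corner lemma: every vertex of the rooted polygon `P(ω)`, `ω ∈ sawFun 2 n e₀`, `n ≥ 2`, has two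
  distinct lattice-neighbours joined to it by edges of `P(ω)`; so at the leftmost vertex `a` of the
  top (bottom) row `{a, a+e₀}` is an edge, and `P(ω)` does not lie in one row.
* Extremal docking: if the root row is not the top row of `P(ω)`, every partner whose root row is
  its bottom row docks above the top-left edge (`a + e₁ ∈ dockings j k ω ω'`: the translate lies
  strictly above `P(ω)`); otherwise every partner whose root row is its top row docks below the
  bottom-left edge. So `Σ_{ω'} |dockings j k ω ω'| ≥ #(bottom-rooted)` or `≥ #(top-rooted)`.
* Re-rooting count: re-rooting `ω'` at its bottom-left (top-left) edge — translate, open the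
  polygon at the root edge — is at most `(k+1)`-to-one (the old origin is one of the `k+1` vertices,
  and a rooted polygon determines its walk), so `c_k ≤ (k+1) #(bottom-rooted)`, `≤ (k+1) #(top-rooted)`.
* Hence `c_j c_k ≤ (k+1) Σ_{ω,ω'} |dockings| ≤ 2^{i+1} Σ_{ω,ω'} |dockings|` for `j, k ∈ B_i`, `i ≥ 1`,
  and `R_i² ≤ 2^{i+1} dockMass i`.

Sources: N. Madras, G. Slade, *The Self-Avoiding Walk* (1993), §1.4, Definition 3.2.1;
A. Hammond, Ann. Probab. 46 (2018), §4.1 (join plaquettes). Elementary combinatorics ([folklore]).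
-/

noncomputable section

open Literature.Probability.LatticeModels
open Literature.Probability.RandomPlanarGeometry Literature.Probability.RandomPlanarGeometry.SAW
open scoped BigOperators
open Summit.CriticalPhenomena.SAWScalingLimit.Theorems.CriticalBubbleBound.Negative (e₀)

namespace Summit.CriticalPhenomena.SAWScalingLimit.Theorems.CriticalBubbleBound.Docking

/-! ## Lattice bookkeeping -/

/-- Coordinates of `e₀ = (1, 0)` and `e₁ = (0, 1)`. [folklore] -/
theorem e₀_e₁_apply : e₀ 0 = 1 ∧ e₀ 1 = 0 ∧ e₁ 0 = 0 ∧ e₁ 1 = 1 := ⟨rfl, rfl, rfl, rfl⟩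

/-- The neighbours of a site `a` of `ℤ²` are `a ± e₀`, `a ± e₁`. [folklore] -/
theorem adj_cases {a x : Site 2} (h : (zdGraph 2).Adj a x) :
    x = a + e₀ ∨ x = a - e₀ ∨ x = a + e₁ ∨ x = a - e₁ := by
  obtain ⟨i, hi | hi⟩ := (zdGraph_adj_iff a x).1 h
  · fin_cases i
    · exact Or.inl (by rw [hi, e₀_eq_single]; rfl)
    · exact Or.inr (Or.inr (Or.inl (by rw [hi, e₁_eq_single]; rfl)))
  · fin_cases i
    · exact Or.inr (Or.inl (by rw [hi, e₀_eq_single]; simp))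
    · exact Or.inr (Or.inr (Or.inr (by rw [hi, e₁_eq_single]; simp)))

/-- Only `a = 0` has `{a, a + e₀}` equal to the root edge `{0, e₀}`. [folklore] -/
theorem eq_zero_of_mk_eq_rootEdge {a : Site 2} (h : s(a, a + e₀) = rootEdge) : a = 0 := by
  rw [rootEdge, Sym2.eq_iff] at h
  rcases h with ⟨h, -⟩ | ⟨h1, h2⟩
  · exact h
  · rw [h1] at h2
    have h' := congrFun h2 0
    simp only [Pi.add_apply, e₀_e₁_apply.1, Pi.zero_apply] at h'
    omega

/-- A nonempty finite set of sites has an `f`-maximal point with minimal abscissa among the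
`f`-maximal ones (top-left point for `f = y`, bottom-left point for `f = -y`). [folklore] -/
theorem exists_max_left {S : Finset (Site 2)} (hS : S.Nonempty) (f : Site 2 → ℤ) :
    ∃ a ∈ S, (∀ x ∈ S, f x ≤ f a) ∧ ∀ x ∈ S, f x = f a → a 0 ≤ x 0 := by
  classical
  obtain ⟨t, ht, htmax⟩ := S.exists_max_image f hS
  obtain ⟨a, ha, hamin⟩ := (S.filter fun x => f x = f t).exists_min_image (fun x => x 0)
    ⟨t, Finset.mem_filter.2 ⟨ht, rfl⟩⟩
  rw [Finset.mem_filter] at ha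
  refine ⟨a, ha.1, fun x hx => ha.2 ▸ htmax x hx, fun x hx hxa =>
    hamin x (Finset.mem_filter.2 ⟨hx, ?_⟩)⟩
  rw [hxa, ha.2]

/-! ## The two polygon-neighbours of a vertex, corners, extremal edges -/

/-- `ω i ∈ verts n ω` for `i ≤ n`. [folklore] -/
theorem apply_mem_verts {n : ℕ} (ω : ℕ → Site 2) {i : ℕ} (hi : i ≤ n) : ω i ∈ verts n ω :=
  Finset.mem_image.2 ⟨i, Finset.mem_range.2 (Nat.lt_succ_of_le hi), rfl⟩

/-- Every vertex `ω m` (`m ≤ n`) of the rooted polygon of `ω ∈ sawFun 2 n e₀`, `n ≥ 2`, has two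
distinct lattice-neighbours among the vertices, joined to it by edges of the polygon (its cyclic
predecessor and successor; the root edge closes the cycle). [cite: MadrasSlade1993, Definition 3.2.1] -/
theorem two_neighbours {n : ℕ} {ω : ℕ → Site 2} (hω : ω ∈ Zd.sawFun 2 n e₀) (hn : 2 ≤ n) {m : ℕ}
    (hm : m ≤ n) :
    ∃ p ∈ verts n ω, ∃ q ∈ verts n ω, p ≠ q ∧ (zdGraph 2).Adj (ω m) p ∧ (zdGraph 2).Adj (ω m) q ∧
      s(ω m, p) ∈ pedges n ω ∧ s(ω m, q) ∈ pedges n ω := by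
  obtain ⟨h0, hend, hadj, hinj⟩ := Zd.mem_sawFun.1 hω
  have hI : ∀ {i j}, i ≤ n → j ≤ n → ω i = ω j → i = j := fun hi hj h => hinj hi hj h
  have hstep : ∀ i < n, s(ω i, ω (i + 1)) ∈ pedges n ω := fun i hi =>
    Finset.mem_insert_of_mem (Finset.mem_image.2 ⟨i, Finset.mem_range.2 hi, rfl⟩)
  have hroot : s(ω n, ω 0) ∈ pedges n ω := Finset.mem_insert_self _ _
  rcases Nat.eq_zero_or_pos m with rfl | hm0
  · -- `m = 0`: neighbours `ω 1` and `ω n = e₀`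
    exact ⟨ω 1, apply_mem_verts ω (by omega), ω n, apply_mem_verts ω le_rfl,
      fun h => by have := hI (by omega) le_rfl h; omega, hadj 0 (by omega),
      by rw [h0, hend n le_rfl]; exact Negative.adj_zero_e₀, hstep 0 (by omega),
      by rw [Sym2.eq_swap]; exact hroot⟩
  · have em : m - 1 + 1 = m := by omega
    have hpa : (zdGraph 2).Adj (ω m) (ω (m - 1)) := by
      have := hadj (m - 1) (by omega); rw [em] at this; exact this.symm
    have hpe : s(ω m, ω (m - 1)) ∈ pedges n ω := by
      have := hstep (m - 1) (by omega); rwa [em, Sym2.eq_swap] at this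
    rcases lt_or_eq_of_le hm with hmn | rfl
    · -- `0 < m < n`: neighbours `ω (m-1)` and `ω (m+1)`
      exact ⟨ω (m - 1), apply_mem_verts ω (by omega), ω (m + 1), apply_mem_verts ω (by omega),
        fun h => by have := hI (by omega) (by omega) h; omega, hpa, hadj m hmn, hpe, hstep m hmn⟩
    · -- `m = n`: neighbours `ω (n-1)` and `ω 0 = 0`
      exact ⟨ω (m - 1), apply_mem_verts ω (by omega), ω 0, apply_mem_verts ω m.zero_le,
        fun h => by have := hI (by omega) m.zero_le h; omega, hpa,
        by rw [hend m le_rfl, h0]; exact Negative.adj_zero_e₀.symm, hpe, hroot⟩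

/-- **Corner lemma.** If `a` is a vertex of the rooted polygon of `ω ∈ sawFun 2 n e₀` (`n ≥ 2`)
such that `a - e₀` is not a vertex and `a + e₁` or `a - e₁` is not a vertex, then `{a, a + e₀}` is
an edge of the polygon (the two polygon-neighbours of `a` are distinct lattice-neighbours).
[folklore] -/
theorem mem_pedges_of_corner {n : ℕ} {ω : ℕ → Site 2} (hω : ω ∈ Zd.sawFun 2 n e₀) (hn : 2 ≤ n)
    {a : Site 2} (ha : a ∈ verts n ω) (h₀ : a - e₀ ∉ verts n ω)
    (h₁ : a + e₁ ∉ verts n ω ∨ a - e₁ ∉ verts n ω) : s(a, a + e₀) ∈ pedges n ω := by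
  obtain ⟨m, hm, rfl⟩ := Finset.mem_image.1 ha
  obtain ⟨p, hp, q, hq, hpq, hap, haq, hpe, hqe⟩ :=
    two_neighbours hω hn (Nat.lt_succ_iff.1 (Finset.mem_range.1 hm))
  rcases adj_cases hap with rfl | rfl | rfl | rfl <;>
    rcases adj_cases haq with rfl | rfl | rfl | rfl <;>
    first
    | exact hpe
    | exact hqe
    | exact (h₀ hp).elim
    | exact (h₀ hq).elim
    | exact (hpq rfl).elim
    | exact (h₁.elim (fun h => h hp) fun h => h hq).elim
    | exact (h₁.elim (fun h => h hq) fun h => h hp).elim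

/-- The top-left vertex `t` of the rooted polygon of `ω ∈ sawFun 2 n e₀` (`n ≥ 2`): all vertices
lie weakly below it and `{t, t + e₀}` is an edge of the polygon. [folklore] -/
theorem exists_top_corner {n : ℕ} {ω : ℕ → Site 2} (hω : ω ∈ Zd.sawFun 2 n e₀) (hn : 2 ≤ n) :
    ∃ t ∈ verts n ω, s(t, t + e₀) ∈ pedges n ω ∧ ∀ x ∈ verts n ω, x 1 ≤ t 1 := by
  obtain ⟨t, ht, htmax, htleft⟩ :=
    exists_max_left (S := verts n ω) ⟨ω 0, apply_mem_verts ω n.zero_le⟩ fun x => x 1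
  refine ⟨t, ht, mem_pedges_of_corner hω hn ht (fun h => ?_) (Or.inl fun h => ?_), htmax⟩
  · have h1 := htleft _ h (by simp [e₀_e₁_apply])
    simp only [Pi.sub_apply, e₀_e₁_apply.1] at h1
    omega
  · have h1 := htmax _ h
    simp only [Pi.add_apply, e₀_e₁_apply.2.2.2] at h1
    omega

/-- The bottom-left vertex `b` of the rooted polygon of `ω ∈ sawFun 2 n e₀` (`n ≥ 2`): all
vertices lie weakly above it and `{b, b + e₀}` is an edge of the polygon. [folklore] -/
theorem exists_bottom_corner {n : ℕ} {ω : ℕ → Site 2} (hω : ω ∈ Zd.sawFun 2 n e₀) (hn : 2 ≤ n) :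
    ∃ b ∈ verts n ω, s(b, b + e₀) ∈ pedges n ω ∧ ∀ x ∈ verts n ω, b 1 ≤ x 1 := by
  obtain ⟨b, hb, hbmin, hbleft⟩ :=
    exists_max_left (S := verts n ω) ⟨ω 0, apply_mem_verts ω n.zero_le⟩ fun x => -x 1
  simp only [neg_le_neg_iff, neg_inj] at hbmin hbleft
  refine ⟨b, hb, mem_pedges_of_corner hω hn hb (fun h => ?_) (Or.inr fun h => ?_), hbmin⟩
  · have h1 := hbleft _ h (by simp [e₀_e₁_apply])
    simp only [Pi.sub_apply, e₀_e₁_apply.1] at h1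
    omega
  · have h1 := hbmin _ h
    simp only [Pi.sub_apply, e₀_e₁_apply.2.2.2] at h1
    omega

/-- For `n ≥ 2` the rooted polygon of `ω ∈ sawFun 2 n e₀` is not contained in one row: the
rightmost vertex of a one-row polygon would have only one possible polygon-neighbour. [folklore] -/
theorem exists_verts_apply_one_ne {n : ℕ} {ω : ℕ → Site 2} (hω : ω ∈ Zd.sawFun 2 n e₀) (hn : 2 ≤ n)
    (y : ℤ) : ∃ x ∈ verts n ω, x 1 ≠ y := by
  by_contra h
  push Not at h
  obtain ⟨c, hc, hcmax⟩ :=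
    (verts n ω).exists_max_image (fun x => x 0) ⟨ω 0, apply_mem_verts ω n.zero_le⟩
  obtain ⟨m, hm, rfl⟩ := Finset.mem_image.1 hc
  obtain ⟨p, hp, q, hq, hpq, hap, haq, -, -⟩ :=
    two_neighbours hω hn (Nat.lt_succ_iff.1 (Finset.mem_range.1 hm))
  have key : ∀ z ∈ verts n ω, (zdGraph 2).Adj (ω m) z → z = ω m - e₀ := by
    intro z hz haz
    have hy := h _ hz
    have hy0 := h _ hc
    rcases adj_cases haz with rfl | rfl | rfl | rfl
    · have h1 := hcmax _ hz
      simp only [Pi.add_apply, e₀_e₁_apply.1] at h1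
      omega
    · rfl
    · simp only [Pi.add_apply, e₀_e₁_apply.2.2.2] at hy
      omega
    · simp only [Pi.sub_apply, e₀_e₁_apply.2.2.2] at hy
      omega
  exact hpq ((key p hp hap).trans (key q hq haq).symm)

/-- **Extremal non-root horizontal edge.** The rooted polygon of `ω ∈ sawFun 2 n e₀` (`n ≥ 2`) has
a horizontal edge `{a, a + e₀} ≠ rootEdge` with all vertices weakly below `a` (top-left corner) or
all vertices weakly above `a` (bottom-left corner): both corners cannot be the origin, since the
polygon does not lie in the root row. [folklore] -/
theorem exists_extremal_edge {n : ℕ} {ω : ℕ → Site 2} (hω : ω ∈ Zd.sawFun 2 n e₀) (hn : 2 ≤ n) :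
    ∃ a ∈ verts n ω, s(a, a + e₀) ∈ pedges n ω ∧ s(a, a + e₀) ≠ rootEdge ∧
      ((∀ x ∈ verts n ω, x 1 ≤ a 1) ∨ (∀ x ∈ verts n ω, a 1 ≤ x 1)) := by
  obtain ⟨t, ht, hte, htmax⟩ := exists_top_corner hω hn
  obtain ⟨b, hb, hbe, hbmin⟩ := exists_bottom_corner hω hn
  by_cases htr : s(t, t + e₀) = rootEdge
  · by_cases hbr : s(b, b + e₀) = rootEdge
    · obtain ⟨x, hx, hx1⟩ := exists_verts_apply_one_ne hω hn 0
      exact (hx1 (le_antisymm (by simpa [eq_zero_of_mk_eq_rootEdge htr] using htmax x hx)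
        (by simpa [eq_zero_of_mk_eq_rootEdge hbr] using hbmin x hx))).elim
    · exact ⟨b, hb, hbe, hbr, Or.inr hbmin⟩
  · exact ⟨t, ht, hte, htr, Or.inl htmax⟩

/-- **Top docking.** If all vertices of `P(ω)` lie weakly below the vertex `a` and `{a, a + e₀}` is
a non-root edge, then every partner `χ` with all heights `≥ 0` docks at `v = a + e₁` (its translate
lies strictly above `P(ω)`, its root edge just above `{a, a + e₀}`). [folklore] -/
theorem mem_dockings_top {j k : ℕ} {ω χ : ℕ → Site 2} {a : Site 2} (ha : a ∈ verts j ω)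
    (hae : s(a, a + e₀) ∈ pedges j ω) (har : s(a, a + e₀) ≠ rootEdge)
    (htop : ∀ x ∈ verts j ω, x 1 ≤ a 1) (hχ : ∀ m ≤ k, 0 ≤ χ m 1) :
    a + e₁ ∈ dockings j k ω χ := by
  classical
  rw [dockings, Finset.mem_filter]
  refine ⟨Finset.mem_union_left _ (Finset.mem_image.2 ⟨a, ha, rfl⟩), ?_, Or.inl ?_⟩
  · rw [Finset.disjoint_left]
    intro x hx hx'
    obtain ⟨m, hm, rfl⟩ := Finset.mem_image.1 hx'
    have h1 := htop _ hx
    have h2 := hχ m (Nat.lt_succ_iff.1 (Finset.mem_range.1 hm))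
    simp only [shift_eval, Pi.add_apply, e₀_e₁_apply.2.2.2] at h1
    omega
  · have e2 : a + e₁ + e₀ - e₁ = a + e₀ := by abel
    rw [add_sub_cancel_right, e2]
    exact ⟨hae, har⟩

/-- **Bottom docking.** If all vertices of `P(ω)` lie weakly above the vertex `a` and `{a, a + e₀}`
is a non-root edge, then every partner `χ` with all heights `≤ 0` docks at `v = a - e₁`. [folklore] -/
theorem mem_dockings_bottom {j k : ℕ} {ω χ : ℕ → Site 2} {a : Site 2} (ha : a ∈ verts j ω)
    (hae : s(a, a + e₀) ∈ pedges j ω) (har : s(a, a + e₀) ≠ rootEdge)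
    (hbot : ∀ x ∈ verts j ω, a 1 ≤ x 1) (hχ : ∀ m ≤ k, χ m 1 ≤ 0) :
    a - e₁ ∈ dockings j k ω χ := by
  classical
  rw [dockings, Finset.mem_filter]
  refine ⟨Finset.mem_union_right _ (Finset.mem_image.2 ⟨a, ha, rfl⟩), ?_, Or.inr ?_⟩
  · rw [Finset.disjoint_left]
    intro x hx hx'
    obtain ⟨m, hm, rfl⟩ := Finset.mem_image.1 hx'
    have h1 := hbot _ hx
    have h2 := hχ m (Nat.lt_succ_iff.1 (Finset.mem_range.1 hm))
    simp only [shift_eval, Pi.add_apply, Pi.sub_apply, e₀_e₁_apply.2.2.2] at h1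
    omega
  · have e2 : a - e₁ + e₀ + e₁ = a + e₀ := by abel
    rw [sub_add_cancel, e2]
    exact ⟨hae, har⟩

/-- **Extremal docking count.** For `ω ∈ sawFun 2 j e₀`, `j ≥ 2`: either every bottom-rooted
partner (all heights `≥ 0`) or every top-rooted partner (all heights `≤ 0`) of size `k` admits a
docking against `P(ω)`, so `Σ_{ω'} |dockings j k ω ω'|` is at least the number of such partners.
[folklore] -/
theorem card_filter_le_sum_card_dockings {j k : ℕ} {ω : ℕ → Site 2} (hω : ω ∈ Zd.sawFun 2 j e₀)
    (hj : 2 ≤ j) :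
    ((Zd.sawFun 2 k e₀).filter fun χ => ∀ m ≤ k, 0 ≤ χ m 1).card ≤
        ∑ ω' ∈ Zd.sawFun 2 k e₀, (dockings j k ω ω').card ∨
      ((Zd.sawFun 2 k e₀).filter fun χ => ∀ m ≤ k, χ m 1 ≤ 0).card ≤
        ∑ ω' ∈ Zd.sawFun 2 k e₀, (dockings j k ω ω').card := by
  classical
  obtain ⟨a, ha, hae, har, htop | hbot⟩ := exists_extremal_edge hω hj
  · refine Or.inl (le_trans ?_ (Finset.sum_le_sum_of_subset_of_nonneg
      (Finset.filter_subset (fun χ => ∀ m ≤ k, 0 ≤ χ m 1) _) fun _ _ _ => Nat.zero_le _))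
    rw [Finset.card_eq_sum_ones]
    exact Finset.sum_le_sum fun χ hχ => Finset.one_le_card.2
      ⟨_, mem_dockings_top ha hae har htop (Finset.mem_filter.1 hχ).2⟩
  · refine Or.inr (le_trans ?_ (Finset.sum_le_sum_of_subset_of_nonneg
      (Finset.filter_subset (fun χ => ∀ m ≤ k, χ m 1 ≤ 0) _) fun _ _ _ => Nat.zero_le _))
    rw [Finset.card_eq_sum_ones]
    exact Finset.sum_le_sum fun χ hχ => Finset.one_le_card.2
      ⟨_, mem_dockings_bottom ha hae har hbot (Finset.mem_filter.1 hχ).2⟩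

/-- **Re-rooting count.** If every `ω' ∈ sawFun 2 k e₀` (`k ≥ 2`) has a vertex `b` with `{b, b+e₀}`
an edge of `P(ω')` and `P` true on `P(ω') - b`, then re-rooting there (translate by `-b`, open at the
root edge) gives `χ ∈ sawFun 2 k e₀` with all vertices in `P`, and `ω'` is recovered from `χ` and the
index of the old origin among the `k+1` vertices of `χ`; so `c_k(0,e₀) ≤ (k+1) · #{χ : P}`. [folklore] -/
theorem card_sawFun_le_reroot {k : ℕ} (hk : 2 ≤ k) (P : Site 2 → Prop) [DecidablePred P]
    (h : ∀ ω' ∈ Zd.sawFun 2 k e₀, ∃ b ∈ verts k ω', s(b, b + e₀) ∈ pedges k ω' ∧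
      ∀ x ∈ verts k ω', P (x - b)) :
    (Zd.sawFun 2 k e₀).card ≤
      (k + 1) * ((Zd.sawFun 2 k e₀).filter fun χ => ∀ m ≤ k, P (χ m)).card := by
  classical
  set S := Zd.sawFun 2 k e₀
  set B := S.filter fun χ => ∀ m ≤ k, P (χ m)
  have himg : ∀ ω' : ℕ → Site 2, ∃ p : (ℕ → Site 2) × ℕ, ω' ∈ S →
      p ∈ B ×ˢ Finset.range (k + 1) ∧ pedges k (shift (-(p.1 p.2)) p.1) = pedges k ω' := by
    intro ω'
    by_cases hω' : ω' ∈ S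
    · obtain ⟨b, -, hbe, hP⟩ := h ω' hω'
      have hpoly := pedges_shift_isPolygon hω' hk 0
      rw [shift_by_zero] at hpoly
      obtain ⟨χ, hχ, hχe⟩ := exists_sawFun_shift_of_isPolygon hpoly.1 hbe hpoly.2
      have hverts : ∀ x, x ∈ verts k (shift b χ) ↔ x ∈ verts k ω' := fun x => by
        rw [← exists_mem_pedges_iff, ← exists_mem_pedges_iff, hχe]
      have h0 : (0 : Site 2) ∈ verts k (shift b χ) := by
        rw [hverts, ← (Zd.mem_sawFun.1 hω').1]
        exact apply_mem_verts ω' k.zero_le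
      obtain ⟨m, hm, hm0⟩ := Finset.mem_image.1 h0
      have hb : -(χ m) = b := neg_eq_of_add_eq_zero_right hm0
      refine ⟨(χ, m), fun _ => ⟨Finset.mem_product.2 ⟨Finset.mem_filter.2 ⟨hχ, fun i hi => ?_⟩, hm⟩,
        by rw [hb]; exact hχe⟩⟩
      have hi' := hP _ ((hverts _).1 (apply_mem_verts (shift b χ) hi))
      simpa using hi'
    · exact ⟨(fun _ => 0, 0), fun h' => (hω' h').elim⟩
  choose Ψ hΨ using himg
  have hinj : Set.InjOn Ψ ↑S := by
    intro ω₁ h₁ ω₂ h₂ heq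
    rw [Finset.mem_coe] at h₁ h₂
    have e₁' := (hΨ ω₁ h₁).2
    have e₂' := (hΨ ω₂ h₂).2
    rw [heq] at e₁'
    exact eq_of_pedges_shift_eq h₁ h₂ hk (v := 0)
      (by rw [shift_by_zero, shift_by_zero]; exact e₁'.symm.trans e₂')
  calc S.card ≤ (B ×ˢ Finset.range (k + 1)).card :=
        Finset.card_le_card_of_injOn Ψ (fun ω hω => (hΨ ω hω).1) hinj
    _ = (k + 1) * B.card := by rw [Finset.card_product, Finset.card_range, mul_comm]

/-- **Per-pair count.** For `j, k ≥ 2`: `c_j(0,e₀) · c_k(0,e₀) ≤ (k+1) · Σ_{ω,ω'} |dockings j k ω ω'|`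
(extremal docking of the bottom- or top-rooted partners, and the re-rooting count). [folklore] -/
theorem card_mul_card_le_sum_dockings {j k : ℕ} (hj : 2 ≤ j) (hk : 2 ≤ k) :
    (Zd.sawFun 2 j e₀).card * (Zd.sawFun 2 k e₀).card ≤
      (k + 1) * ∑ ω ∈ Zd.sawFun 2 j e₀, ∑ ω' ∈ Zd.sawFun 2 k e₀, (dockings j k ω ω').card := by
  classical
  have hB := card_sawFun_le_reroot hk (fun x => 0 ≤ x 1) fun ω' hω' => by
    obtain ⟨b, hb, hbe, hbmin⟩ := exists_bottom_corner hω' hk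
    exact ⟨b, hb, hbe, fun x hx => by simpa only [Pi.sub_apply, sub_nonneg] using hbmin x hx⟩
  have hT := card_sawFun_le_reroot hk (fun x => x 1 ≤ 0) fun ω' hω' => by
    obtain ⟨t, ht, hte, htmax⟩ := exists_top_corner hω' hk
    exact ⟨t, ht, hte, fun x hx => by simpa only [Pi.sub_apply, sub_nonpos] using htmax x hx⟩
  rw [Finset.card_eq_sum_ones (Zd.sawFun 2 j e₀), Finset.sum_mul, Finset.mul_sum]
  refine Finset.sum_le_sum fun ω hω => ?_
  rw [one_mul]
  rcases card_filter_le_sum_card_dockings (k := k) hω hj with h | h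
  · exact hB.trans (Nat.mul_le_mul_left _ h)
  · exact hT.trans (Nat.mul_le_mul_left _ h)

/-- **Block form.** For `i ≥ 1`, `R_i² ≤ 2^{i+1} · dockMass i`: expand the square over pairs
`j, k ∈ B_i` and use the per-pair count with `k + 1 ≤ 2^{i+1}` (`j, k ≥ 2^i ≥ 2`).
[cite: MadrasSlade1993, §1.4] -/
theorem blockMass_sq_le_dockMass {i : ℕ} (hi : 1 ≤ i) :
    blockMass term i ^ 2 ≤ 2 ^ (i + 1) * dockMass i := by
  classical
  have hx := criticalFugacity_pos_lt_one'.1.le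
  rw [blockMass, sq, Finset.sum_mul_sum, dockMass, Finset.mul_sum]
  refine Finset.sum_le_sum fun j hj => ?_
  rw [Finset.mul_sum]
  refine Finset.sum_le_sum fun k hk => ?_
  rw [block, Finset.mem_Ico] at hj hk
  have h2i : 2 ≤ 2 ^ i := Nat.one_lt_two_pow (by omega)
  have key := (card_mul_card_le_sum_dockings (h2i.trans hj.1) (h2i.trans hk.1)).trans
    (Nat.mul_le_mul_right _ (show k + 1 ≤ 2 ^ (i + 1) from hk.2))
  rify at key
  rw [Zd.card_sawFun, Zd.card_sawFun] at key
  simp_rw [term, ← Finset.sum_mul]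
  calc (Zd.countAt 2 j e₀ : ℝ) * criticalFugacity ^ j * ((Zd.countAt 2 k e₀ : ℝ) * criticalFugacity ^ k)
        = (Zd.countAt 2 j e₀ : ℝ) * (Zd.countAt 2 k e₀ : ℝ) *
            (criticalFugacity ^ j * criticalFugacity ^ k) := by ring
    _ ≤ (2 : ℝ) ^ (i + 1) * (∑ ω ∈ Zd.sawFun 2 j e₀, ∑ ω' ∈ Zd.sawFun 2 k e₀,
          ((dockings j k ω ω').card : ℝ)) * (criticalFugacity ^ j * criticalFugacity ^ k) :=
        mul_le_mul_of_nonneg_right key (mul_nonneg (pow_nonneg hx j) (pow_nonneg hx k))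
    _ = _ := mul_assoc _ _ _

/-- **Stub `dockingEntropy_zero` (the provable floor `κ = 0` of the docking entropy).** With
`c = 1/2` and `i₀ = 1`: for every `i ≥ 1`, `(1/2) · 2^{(0-1) i} · R_i² ≤ dockMass i` — on
`x_c`-average two rooted critical polygons with sizes in `B_i` admit at least `2^{-(i+1)}`
root-edge plaquette dockings (extremal-row dockings; `blockMass_sq_le_dockMass`).
[cite: MadrasSlade1993, §1.4] -/
theorem dockingEntropy_zero : DockingEntropy 0 := by
  unfold DockingEntropy
  refine ⟨1 / 2, by norm_num, 1, fun i hi => ?_⟩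
  have e : ((0 : ℝ) - 1) * (i : ℝ) = -(i : ℝ) := by ring
  rw [e, Real.rpow_neg (by norm_num : (0 : ℝ) ≤ 2), Real.rpow_natCast]
  calc 1 / 2 * ((2 : ℝ) ^ i)⁻¹ * blockMass term i ^ 2 = blockMass term i ^ 2 / 2 ^ (i + 1) := by ring
    _ ≤ dockMass i := by
        rw [div_le_iff₀ (by positivity), mul_comm]; exact blockMass_sq_le_dockMass hi

end Summit.CriticalPhenomena.SAWScalingLimit.Theorems.CriticalBubbleBound.Docking

end
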